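import Literature.Combinatorics.Optimization.CompletelyPositiveGraphs
import HarnessLib

/-!
# The cone of completely positive semidefinite matrices is not closed and the cpsd-rank is unbounded
# (Dykema–Paulsen–Prakash 2019), answering PSVW's Question and FGPRT Problem 9.11 for `n ≥ 10`

Recent-theorem / open-question harvest for the two sources of the typing row FGPRT + PSVW
(`CompletelyPsdRank.lean`, `PsdRankComparisons.lean`, …, same directory).

The questions, as printed.
* FGPRT = Fawzi–Gouveia–Parrilo–Robinson–Thomas, *Positive semidefinite rank*, Math. Program. 153
  (2015) = arXiv:1407.4095 [FawziEtAl2015] (held text `paper:arxiv-1407.4095`): §8 (p23) "One important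
  question is to know whether the cone `CS^n` is closed"; **Problem 9.11** (p25) "Let `CS^n` be the set
  of `n × n` matrices `M` that admit a factorization `M_{ij} = ⟨A_i, A_j⟩` where `A_1,…,A_n` are psd
  matrices. Does there exist a function `f(n)` such that any matrix `M ∈ CS^n` admits [such] a
  factorization where the factors `A_1,…,A_n` have size at most `f(n)`?"
* PSVW = Prakash–Sikora–Varvitsiotis–Wei, *Completely positive semidefinite rank*, Math. Program. 171
  (2018) = arXiv:1604.07199 [PrakashEtAl2017] (held text `paper:arxiv-1604.07199`): p03 "it is not known
  whether `CS_+^n` is closed"; p05–p06 "**Question:** Is `max{cpsd-rank(X) : X ∈ CS_+^n}` finite or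
  infinite? … The question concerning the finiteness of the cpsd-rank was already stated in [FGPRT]."

The answer (2017–2019), as printed.
* Dykema–Paulsen–Prakash, *Non-closure of the set of quantum correlations via graphs*, Commun. Math.
  Phys. 365 (2019) 1125–1142 = arXiv:1709.05032 [DykemaPaulsenPrakash2019] (held text
  `paper:arxiv-1709.05032`), **Theorem 4.2** (p11, verbatim): "The synchronous correlation set
  `C_q^s(5,2)` is not closed." (PROVED there: graph correlation functions of `K_5` + the
  Kruglyak–Rabanovich–Samoĭlenko theorem on sums of projections; Corollary 4.4 (p11): `C_q(5,2)` and
  `C_{qs}(5,2)` are not closed.) Earlier: Slofstra, Forum Math. Pi 7 (2019) [Slofstra2019], for a large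
  Bell scenario.
* The consequence for the cpsd cone, verbatim: Gribling–de Laat–Laurent, Found. Comput. Math. 19 (2019)
  [GriblingDelaatLaurent2019], §1 (held text `paper:arxiv-1708.01573`, p04): "it follows from results in
  [Slofstra17] that the cone `CS_+^n` is not closed for `n ≥ 1942`. The results in [DPP17] show that this
  already holds for `n ≥ 10`. As a consequence there does not exist an upper bound on the cpsd-rank as a
  function of the matrix size."; Abbasi–Klingler–Netzer, Linear Algebra Appl. 677 (2023) = arXiv:2012.06471
  [AbbasiKlinglerNetzer2020] (held text `paper:arxiv-2012.06471`), §2 p05 (same statement, "it remains an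
  open problem whether the cone is closed for `n ∈ {5,6,7,8,9}`"), **Lemma 7** (p06: "For each `n, r ≥ 1`
  the set `CPSD^n_{≤ r}` is closed and semialgebraic", Bolzano–Weierstrass) and **Corollary 8** (p06: "For
  `n ≥ 10` the cpsd-rank of elements from `CPSD^n` are unbounded", from non-closure + Lemma 7).

What this file does. ONE named fact — DPP Theorem 4.2, the statement proved in print — and everything
else PROVED from it in the tree's cpsd vocabulary (`HasCpsdFactorization`, `IsCpsd` of
`CompletelyPsdRank.lean`, Hermitian psd factors as in PSVW Def. 1):
* `syncQuantumCorr n k` — the synchronous quantum correlation set `C_q^s(n,k) ⊆ ℝ^{n²k²}`, typed through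
  its finite-dimensional tracial characterisation **DPP Corollary 2.12 = Paulsen–Severini–Stahlke–
  Todorov–Winter [PaulsenEtAl2016] Cor. 5.6** (p06, verbatim): "`(p(i,j|v,w)) ∈ C_q^s(n,k)` if and only
  if there exists a finite dimensional C*-algebra `𝒜` with a tracial state `τ` and with a generating family
  `{e_{v,i}} ⊆ 𝒜` of projections such that `Σ_i e_{v,i} = 1` for all `v` and `p(i,j|v,w) = τ(e_{v,i}
  e_{w,j})`". ENCODING (the only non-verbatim step, [folklore]: Wedderburn + uniqueness of the trace on
  `M_d(ℂ)`): a finite-dimensional C*-algebra with a tracial state is, up to *-isomorphism, `⊕_{l<L}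
  M_{d_l}(ℂ)` (`d_l ≥ 1`) with `τ = Σ_l λ_l · tr(·)/d_l`, `λ_l ≥ 0`, `Σ_l λ_l = 1`; "generating" may be
  dropped (pass to the generated subalgebra and restrict `τ`). DPP's primary Definition 2.2 (p05:
  finite-dimensional tensor-product PVM strategies) is equivalent to this by the quoted corollary.
* `DykemaPaulsenPrakash2019_thm42 : Prop` — NAMED FACT `¬ IsClosed (syncQuantumCorr 5 2)`.
* PROVED, the dictionary (`mem_syncQuantumCorr_iff`): `p ∈ C_q^s(n,k)` iff the `nk × nk` matrix
  `(p(i,j|v,w))_{(v,i),(w,j)}` (`corrGram p`) is cpsd, `Σ_{i,j} p(i,j|v,w) = 1` and `p(i,j|v,v) = 0`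
  (`i ≠ j`). Forward: the psd matrices `⊕_l √(λ_l/d_l) e^l_{v,i}`. Backward (`exists_tracial_data`): for
  Hermitian psd `P_{v,i}` with these constraints, `Tr(P_{v,i}P_{v,j}) = 0` forces `P_{v,i}P_{v,j} = 0`,
  `Tr(S_vS_w) = 1` forces all `S_v := Σ_i P_{v,i}` to be one matrix `S`; diagonalising `S`, each `P_{v,i}`
  commutes with `S`, and on the eigenspace of a nonzero eigenvalue `s` (dimension `d_s`) the compressions
  `P_{v,i}/s` are projections summing to `1`, with weights `λ_s = s² d_s` summing to `Tr(S²) = 1`.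
* PROVED: `isClosed_syncQuantumCorr_of_isClosed_cpsd` (closed `CS_+^{[n]×[k]}` ⇒ closed `C_q^s(n,k)`:
  the constraints are closed conditions and `p ↦ corrGram p` is continuous), invariance of closedness
  under reindexing (`isClosed_cpsd_iff_of_equiv`) and zero-padding (`isClosed_cpsd_of_le`); hence,
  MODULO THE FACT: **`CS_+^{10}` is not closed** (`not_isClosed_cpsd_fin_ten`), **`CS_+^m` is not closed
  for every `m ≥ 10`** (`not_isClosed_cpsd_of_ten_le`) — the GdLL/AKN sentence.
* PROVED outright: AKN Lemma 7 (`isClosed_setOf_hasCpsdFactorization`: the matrices of cpsd-rank `≤ d`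
  form a closed set — compactness of the psd factor box `‖(P_i)_{ab}‖² ≤ Tr(P_i²) = X_{ii}`) and the
  mechanism of AKN Corollary 8 (`exists_not_hasCpsdFactorization_of_not_isClosed`); hence, MODULO THE
  FACT: **the cpsd-rank is unbounded on `CS_+^m`, `m ≥ 10`** (`cpsdRank_unbounded_of_ten_le`) — PSVW's
  Question answered "infinite" — and **FGPRT Problem 9.11 answered in the negative** in its printed
  real-factor form (`exists_real_cpsd_no_bounded_factorization`, via PSVW's realification `T/√2`,
  `posSemidef_realify` / `trace_realify_mul_realify` of `CompletelyPsdRank.lean`).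

* PROVED outright (appended): **`CS_+^m` is closed for `m ≤ 4`** (`isClosed_cpsd_of_le_four`), since
  there `CP = CS_+ = DNN` (Maxfield–Minc, the tree's `IsDnn.isCp_fin_four` of
  `CompletelyPositiveGraphs.lean`) and `DNN` is closed — AKN §2 p05: "For `n ≤ 4`, it is known that
  `CP^n = CPSD^n = DNN^n` (first proven in [max]), and hence `CPSD^n` is closed"; PSVW p03. With the
  non-closure for `m ≥ 10` this leaves exactly the printed open range `5 ≤ m ≤ 9`.
* Status of FGPRT Problem 9.5 (hardness for FIXED psd rank): see also Shitov, Found. Comput. Math. 24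
  (2024) "Further ∃ℝ-complete problems with PSD matrix factorizations" (not held; acq-13346) — not
  assessed here.

NOT here: the proof of DPP Theorem 4.2 (graph correlation functions `f_q`, `f_{vect}` of `K_5`; the
Kruglyak–Rabanovich–Samoĭlenko theorem on five projections summing to `5t·I`; L-sized operator algebra),
Slofstra's route (`n ≥ 1942`),
the open range `5 ≤ n ≤ 9` (AKN p05: open), complexity statements. FGPRT Problems 9.6 (NP-hardness of
psd rank: Shitov 2017) and 9.8 (explicit 0/1 polytopes of exponential psd rank: Lee–Raghavendra–Steurer
2015, `CutTspStabPsdRank.lean`) are the other two problems of FGPRT §9 resolved in print; 9.1–9.5, 9.7,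
9.9, 9.10 and Problem 5.16 have no published resolution known to the typing seat (2026-08).
-/

noncomputable section

open Matrix Finset
open scoped MatrixOrder ComplexOrder

namespace Literature.Combinatorics.Optimization

/-! ### Synchronous quantum correlations `C_q^s(n,k)` and DPP Theorem 4.2 -/

/-- **The synchronous quantum correlation set `C_q^s(n,k) ⊆ ℝ^{n²k²}`** (`n` inputs, `k` outputs per
party; coordinates `p v w i j = p(i,j|v,w)`), typed through DPP Corollary 2.12 = PSSTW Corollary 5.6
(verbatim in the module docstring): `p ∈ C_q^s(n,k)` iff some finite-dimensional C*-algebra with a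
tracial state `τ` contains projections `e_{v,i}` with `Σ_i e_{v,i} = 1` (all `v`) and `p(i,j|v,w) =
τ(e_{v,i} e_{w,j})`. Encoded concretely ([folklore] Wedderburn: such an algebra is `⊕_{l<L} M_{d_l}(ℂ)`,
`d_l ≥ 1`, and its tracial states are `τ = Σ_l λ_l tr(·)/d_l`, `λ_l ≥ 0`, `Σ λ_l = 1`): blocks
`E l v i ∈ M_{d_l}(ℂ)` that are projections (`Eᴴ = E`, `E² = E`) with `Σ_i E l v i = 1`, weights `wt l`,
and `p(i,j|v,w) = Σ_l (wt_l/d_l) · tr(E l v i · E l w j)`. (A correlation is *synchronous* when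
`p(i,j|v,v) = 0` for `i ≠ j`, p06; that and `Σ_{i,j} p(i,j|v,w) = 1` follow, `mem_syncQuantumCorr_iff`.)
[cite: DykemaPaulsenPrakash2019, Def. 2.2 (p05), §2 synchronous sets + Cor. 2.12 (p06);
PaulsenEtAl2016, Cor. 5.6] -/
def syncQuantumCorr (n k : ℕ) : Set (Fin n → Fin n → Fin k → Fin k → ℝ) :=
  {p | ∃ (L : ℕ) (d : Fin L → ℕ) (wt : Fin L → ℝ)
      (E : (l : Fin L) → Fin n → Fin k → Matrix (Fin (d l)) (Fin (d l)) ℂ),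
      (∀ l, 0 < d l) ∧ (∀ l, 0 ≤ wt l) ∧ ∑ l, wt l = 1 ∧
      (∀ l v i, (E l v i).IsHermitian ∧ E l v i * E l v i = E l v i) ∧
      (∀ l v, ∑ i, E l v i = 1) ∧
      ∀ v w i j, ((p v w i j : ℝ) : ℂ) = ∑ l, ((wt l / d l : ℝ) : ℂ) * (E l v i * E l w j).trace}

/-- **Dykema–Paulsen–Prakash 2019, Theorem 4.2** (p11, verbatim): "The synchronous correlation set
`C_q^s(5,2)` is not closed." (Proved in print from the graph correlation functions of `K_5`,
Propositions 3.x–4.1, and Theorem 6 of Kruglyak–Rabanovich–Samoĭlenko; Corollary 4.4: `C_q(5,2)` and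
`C_{qs}(5,2)` are not closed.) NAMED FACT; its consequences for the cpsd cone are PROVED below.
[cite: DykemaPaulsenPrakash2019, Thm. 4.2 (p11)] -/
def DykemaPaulsenPrakash2019_thm42 : Prop := ¬ IsClosed (syncQuantumCorr 5 2)

/-- The `nk × nk` **correlation Gram matrix** `X_{(v,i),(w,j)} = p(i,j|v,w)` of a tuple `p` (the matrix
whose complete positive semidefiniteness characterises `C_q^s`, `mem_syncQuantumCorr_iff`).
[cite: DykemaPaulsenPrakash2019, Cor. 2.12 (p06); PrakashEtAl2017, Def. 1 (p04)] -/
def corrGram {n k : ℕ} (p : Fin n → Fin n → Fin k → Fin k → ℝ) :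
    Matrix (Fin n × Fin k) (Fin n × Fin k) ℝ :=
  Matrix.of fun a b => p a.1 b.1 a.2 b.2

/-- Entries of `corrGram`. [cite: DykemaPaulsenPrakash2019, Cor. 2.12 (p06)] -/
@[simp] theorem corrGram_apply {n k : ℕ} (p : Fin n → Fin n → Fin k → Fin k → ℝ)
    (a b : Fin n × Fin k) : corrGram p a b = p a.1 b.1 a.2 b.2 := rfl

/-- `p ↦ corrGram p` is continuous (a coordinate permutation). [folklore] -/
private theorem continuous_corrGram (n k : ℕ) :
    Continuous (corrGram : (Fin n → Fin n → Fin k → Fin k → ℝ) → _) := by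
  refine continuous_pi fun a => continuous_pi fun b => ?_
  exact (continuous_apply b.2).comp <| (continuous_apply a.2).comp <|
    (continuous_apply b.1).comp (continuous_apply a.1)
/-! ### Tools -/

/-- `Tr(P Q) = 0` forces `P Q = 0` for psd complex `P, Q` (write `Q = Cᴴ C`; the terms
`c̄_lᵀ P c̄_l ≥ 0` of `Tr(P Cᴴ C)` vanish). [cite: PrakashEtAl2017, Lemma 1 (ii) (p08)] -/
private theorem mul_eq_zero_of_psd_trace_eq_zero {d : ℕ} {P Q : Matrix (Fin d) (Fin d) ℂ}
    (hP : P.PosSemidef) (hQ : Q.PosSemidef) (h : (P * Q).trace = 0) : P * Q = 0 := by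
  classical
  obtain ⟨C, hC⟩ := CStarAlgebra.nonneg_iff_eq_star_mul_self.mp hQ.nonneg
  have hQC : Q = Cᴴ * C := by rw [hC, star_eq_conjTranspose]
  have hsum : (P * Q).trace = ∑ l, star (star (C l)) ⬝ᵥ (P *ᵥ star (C l)) := by
    rw [hQC, ← Matrix.mul_assoc, Matrix.trace_mul_comm]
    simp only [Matrix.trace, Matrix.diag_apply, Matrix.mul_apply, Matrix.conjTranspose_apply,
      dotProduct, Matrix.mulVec, Finset.mul_sum, star_star, Pi.star_apply]
  have hnn : ∀ l, 0 ≤ star (star (C l)) ⬝ᵥ (P *ᵥ star (C l)) := fun l =>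
    hP.dotProduct_mulVec_nonneg (star (C l))
  have hzero : ∀ l, star (star (C l)) ⬝ᵥ (P *ᵥ star (C l)) = 0 := by
    have h0 : ∑ l, star (star (C l)) ⬝ᵥ (P *ᵥ star (C l)) = 0 := by rw [← hsum, h]
    exact fun l => (Finset.sum_eq_zero_iff_of_nonneg fun l _ => hnn l).1 h0 l (Finset.mem_univ l)
  have hker : ∀ l, P *ᵥ star (C l) = 0 := fun l => (hP.dotProduct_mulVec_zero_iff _).1 (hzero l)
  have hPCh : P * Cᴴ = 0 := by
    ext s l
    have := congrFun (hker l) s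
    simpa only [Matrix.mul_apply, Matrix.conjTranspose_apply, Matrix.mulVec, dotProduct,
      Matrix.zero_apply, Pi.zero_apply, Pi.star_apply] using this
  rw [hQC, ← Matrix.mul_assoc, hPCh, Matrix.zero_mul]

/-- `Tr(P Q) ≥ 0` for psd complex `P, Q`. [cite: PrakashEtAl2017, §1.1 (p03)] -/
private theorem trace_mul_nonneg_of_psd {d : ℕ} {P Q : Matrix (Fin d) (Fin d) ℂ}
    (hP : P.PosSemidef) (hQ : Q.PosSemidef) : 0 ≤ (P * Q).trace := by
  obtain ⟨C, hC⟩ := CStarAlgebra.nonneg_iff_eq_star_mul_self.mp hQ.nonneg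
  rw [hC, star_eq_conjTranspose, ← Matrix.mul_assoc, trace_mul_cycle]
  exact (hP.mul_mul_conjTranspose_same C).trace_nonneg

/-- A projection (Hermitian idempotent) is psd: `E = Eᴴ E`. [folklore] -/
private theorem posSemidef_of_proj {d : ℕ} {E : Matrix (Fin d) (Fin d) ℂ}
    (hE : E.IsHermitian ∧ E * E = E) : E.PosSemidef := by
  have : E = Eᴴ * E := by rw [hE.1.eq, hE.2]
  rw [this]
  exact posSemidef_conjTranspose_mul_self E

/-- Projections summing to the identity are pairwise orthogonal (`Σ_j Tr(E_i E_j) = Tr(E_i) =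
Tr(E_i E_i)` with nonnegative terms; PVMs). [cite: DykemaPaulsenPrakash2019, §2 (p05, PVM)] -/
private theorem proj_mul_proj_eq_zero {d k : ℕ} (E : Fin k → Matrix (Fin d) (Fin d) ℂ)
    (hE : ∀ i, (E i).IsHermitian ∧ E i * E i = E i) (hsum : ∑ i, E i = 1) {i j : Fin k}
    (hij : i ≠ j) : E i * E j = 0 := by
  classical
  have hpsd : ∀ i, (E i).PosSemidef := fun i => posSemidef_of_proj (hE i)
  -- `Σ_j Tr(E_i E_j) = Tr(E_i) = Tr(E_i E_i)`, so the off-diagonal traces vanish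
  have htot : ∑ j', (E i * E j').trace = (E i * E i).trace := by
    rw [← trace_sum, ← Finset.mul_sum, hsum, Matrix.mul_one, (hE i).2]
  have hoff : ∑ j' ∈ Finset.univ.erase i, (E i * E j').trace = 0 := by
    have := Finset.sum_erase_add (Finset.univ) (fun j' => (E i * E j').trace) (Finset.mem_univ i)
    rw [htot] at this
    exact add_eq_right.mp this
  have hz := (Finset.sum_eq_zero_iff_of_nonneg fun j' _ => trace_mul_nonneg_of_psd (hpsd i) (hpsd j')).1
    hoff j (Finset.mem_erase.mpr ⟨hij.symm, Finset.mem_univ j⟩)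
  exact mul_eq_zero_of_psd_trace_eq_zero (hpsd i) (hpsd j) hz

/-- Trace is invariant under reindexing along an equivalence. [folklore] -/
private theorem trace_submatrix_equiv' {R : Type*} [AddCommMonoid R] {p q : Type*} [Fintype p]
    [Fintype q] (X : Matrix q q R) (e : p ≃ q) : (X.submatrix e e).trace = X.trace := by
  simp only [trace, diag_apply, submatrix_apply]
  exact Fintype.sum_equiv e _ _ fun _ => rfl

/-- A block-diagonal matrix with psd blocks is psd (`⊕ N_lᴴN_l = (⊕N_l)ᴴ(⊕N_l)`). [folklore] -/
private theorem posSemidef_blockDiagonal' {L : ℕ} {d : Fin L → ℕ}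
    (M : (l : Fin L) → Matrix (Fin (d l)) (Fin (d l)) ℂ) (hM : ∀ l, (M l).PosSemidef) :
    (blockDiagonal' M).PosSemidef := by
  classical
  choose N hN using fun l => CStarAlgebra.nonneg_iff_eq_star_mul_self.mp (hM l).nonneg
  have : blockDiagonal' M = (blockDiagonal' N)ᴴ * blockDiagonal' N := by
    rw [blockDiagonal'_conjTranspose, ← blockDiagonal'_mul]
    congr 1
    funext l
    rw [hN l, star_eq_conjTranspose]
  rw [this]
  exact posSemidef_conjTranspose_mul_self _

/-! ### Direction (a): a synchronous quantum correlation has a trace-normalised cpsd Gram matrix -/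

/-- **`C_q^s(n,k)` ⇒ cpsd**: the Gram matrix of `p ∈ C_q^s(n,k)` is completely positive semidefinite,
with the Hermitian psd factors `P_{(v,i)} = ⊕_l √(λ_l/d_l) · e^l_{v,i}` (`Tr(P_{(v,i)}P_{(w,j)}) =
Σ_l (λ_l/d_l) tr(e^l_{v,i} e^l_{w,j}) = p(i,j|v,w)`). [cite: DykemaPaulsenPrakash2019, Cor. 2.12 (p06);
PrakashEtAl2017, Def. 1 (p04)] -/
theorem isCpsd_corrGram_of_mem {n k : ℕ} {p : Fin n → Fin n → Fin k → Fin k → ℝ}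
    (hp : p ∈ syncQuantumCorr n k) : IsCpsd (corrGram p) := by
  classical
  obtain ⟨L, d, wt, E, hd, hwt, hwt1, hE, hE1, hpE⟩ := hp
  -- factors `P_{(v,i)} = ⊕_l √(wt_l/d_l) E^l_{v,i}`, reindexed to `Fin D`
  let c : Fin L → ℝ := fun l => Real.sqrt (wt l / d l)
  let σ : ((l : Fin L) × Fin (d l)) ≃ Fin (∑ l, d l) := finSigmaFinEquiv
  let B : Fin n × Fin k → Matrix ((l : Fin L) × Fin (d l)) ((l : Fin L) × Fin (d l)) ℂ :=
    fun a => blockDiagonal' fun l => ((c l : ℝ) : ℂ) • E l a.1 a.2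
  refine ⟨∑ l, d l, fun a => (B a).submatrix σ.symm σ.symm, fun a => ?_, fun a b => ?_⟩
  · refine (posSemidef_submatrix_equiv σ.symm).mpr (posSemidef_blockDiagonal' _ fun l => ?_)
    exact (posSemidef_of_proj (hE l a.1 a.2)).smul (Complex.zero_le_real.mpr (Real.sqrt_nonneg _))
  · show ((corrGram p a b : ℝ) : ℂ) =
      ((B a).submatrix σ.symm σ.symm * (B b).submatrix σ.symm σ.symm).trace
    rw [submatrix_mul_equiv (B a) (B b), trace_submatrix_equiv', corrGram_apply, hpE]
    simp only [B]
    rw [← blockDiagonal'_mul, trace_blockDiagonal']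
    refine Finset.sum_congr rfl fun l _ => ?_
    rw [smul_mul_smul_comm, trace_smul, smul_eq_mul, ← Complex.ofReal_mul, ← Real.sqrt_mul
      (div_nonneg (hwt l) (Nat.cast_nonneg _)), Real.sqrt_mul_self (div_nonneg (hwt l) (Nat.cast_nonneg _))]

/-- Elements of `C_q^s(n,k)` are normalised: `Σ_{i,j} p(i,j|v,w) = τ(1) = 1`.
[cite: DykemaPaulsenPrakash2019, Cor. 2.12 (p06)] -/
theorem sum_sum_eq_one_of_mem {n k : ℕ} {p : Fin n → Fin n → Fin k → Fin k → ℝ}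
    (hp : p ∈ syncQuantumCorr n k) (v w : Fin n) : ∑ i, ∑ j, p v w i j = 1 := by
  classical
  obtain ⟨L, d, wt, E, hd, hwt, hwt1, hE, hE1, hpE⟩ := hp
  have key : ∀ l, ∑ i, ∑ j, (E l v i * E l w j).trace = (d l : ℂ) := by
    intro l
    calc ∑ i, ∑ j, (E l v i * E l w j).trace = ((∑ i, E l v i) * (∑ j, E l w j)).trace := by
          rw [Finset.sum_mul, trace_sum]
          refine Finset.sum_congr rfl fun i _ => ?_
          rw [Finset.mul_sum, trace_sum]
      _ = (d l : ℂ) := by rw [hE1, hE1, Matrix.mul_one, trace_one, Fintype.card_fin]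
  let g : Fin L → Fin k → Fin k → ℂ := fun l i j => ((wt l / d l : ℝ) : ℂ) * (E l v i * E l w j).trace
  have e1 : ∑ i, ∑ j, ∑ l, g l i j = ∑ i, ∑ l, ∑ j, g l i j :=
    Finset.sum_congr rfl fun i _ => Finset.sum_comm
  have e2 : ∑ i, ∑ l, ∑ j, g l i j = ∑ l, ∑ i, ∑ j, g l i j := Finset.sum_comm
  have h : ((∑ i, ∑ j, p v w i j : ℝ) : ℂ) = ((1 : ℝ) : ℂ) := by
    push_cast
    simp_rw [hpE]
    change ∑ i, ∑ j, ∑ l, g l i j = 1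
    rw [e1, e2]
    simp only [g]
    simp_rw [← Finset.mul_sum]
    simp_rw [key]
    rw [Complex.ofReal_one.symm, ← hwt1]
    push_cast
    refine Finset.sum_congr rfl fun l _ => ?_
    have : (d l : ℂ) ≠ 0 := by exact_mod_cast (hd l).ne'
    field_simp
  exact_mod_cast h

/-- Elements of `C_q^s(n,k)` are synchronous: `p(i,j|v,v) = τ(e_{v,i}e_{v,j}) = 0` for `i ≠ j`.
[cite: DykemaPaulsenPrakash2019, §2 (p06, "synchronous") + Cor. 2.12] -/
theorem eq_zero_of_mem_of_ne {n k : ℕ} {p : Fin n → Fin n → Fin k → Fin k → ℝ}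
    (hp : p ∈ syncQuantumCorr n k) (v : Fin n) {i j : Fin k} (hij : i ≠ j) : p v v i j = 0 := by
  classical
  obtain ⟨L, d, wt, E, hd, hwt, hwt1, hE, hE1, hpE⟩ := hp
  have h : ((p v v i j : ℝ) : ℂ) = 0 := by
    rw [hpE]
    refine Finset.sum_eq_zero fun l _ => ?_
    rw [proj_mul_proj_eq_zero (E l v) (hE l v) (hE1 l v) hij, trace_zero, mul_zero]
  exact_mod_cast h


/-! ### Direction (b): tracial repackaging of a trace-normalised synchronous cpsd Gram family -/

/-- From psd matrices `P_{v,i}` with `P_{v,i} P_{v,j} = 0` (`i ≠ j`), `Σ_i P_{v,i} = S` for every `v`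
and `Tr(S²) = 1`, build the data of a finite-dimensional C*-algebra with a tracial state and
projections reproducing the numbers `Tr(P_{v,i} P_{w,j})`: diagonalise `S`; on the eigenspace of a
nonzero eigenvalue `s` (dimension `d_s`) the compressions `P_{v,i}/s` are projections summing to the
identity, and the weights `s² d_s` sum to `Tr(S²) = 1` (the elementary dictionary between
trace-normalised cpsd Gram matrices and the tracial data of DPP Cor. 2.12).
[cite: DykemaPaulsenPrakash2019, Cor. 2.12 (p06)] -/
private theorem exists_tracial_data {n k D : ℕ} (P : Fin n → Fin k → Matrix (Fin D) (Fin D) ℂ)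
    (hP : ∀ v i, (P v i).PosSemidef) (horth : ∀ v i j, i ≠ j → P v i * P v j = 0)
    (S : Matrix (Fin D) (Fin D) ℂ) (hSh : S.IsHermitian) (hS : ∀ v, ∑ i, P v i = S)
    (htr : (S * S).trace = 1) :
    ∃ (L : ℕ) (d : Fin L → ℕ) (wt : Fin L → ℝ)
      (E : (l : Fin L) → Fin n → Fin k → Matrix (Fin (d l)) (Fin (d l)) ℂ),
      (∀ l, 0 < d l) ∧ (∀ l, 0 ≤ wt l) ∧ ∑ l, wt l = 1 ∧
      (∀ l v i, (E l v i).IsHermitian ∧ E l v i * E l v i = E l v i) ∧ (∀ l v, ∑ i, E l v i = 1) ∧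
      ∀ v w i j, (P v i * P w j).trace = ∑ l, ((wt l / d l : ℝ) : ℂ) * (E l v i * E l w j).trace := by
  classical
  -- diagonalise `S = U Δ U*`
  set μ : Fin D → ℝ := hSh.eigenvalues with hμ
  set U : Matrix (Fin D) (Fin D) ℂ := (hSh.eigenvectorUnitary : Matrix (Fin D) (Fin D) ℂ) with hU
  have hUU : U * star U = 1 := Unitary.coe_mul_star_self hSh.eigenvectorUnitary
  have hUU' : star U * U = 1 := Unitary.coe_star_mul_self hSh.eigenvectorUnitary
  set Δ : Matrix (Fin D) (Fin D) ℂ := diagonal fun a => (μ a : ℂ) with hΔ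
  have hSdiag : S = U * Δ * star U := by
    have h := hSh.spectral_theorem
    rw [Unitary.conjStarAlgAut_apply] at h
    simpa [hΔ, hμ, hU, Function.comp_def] using h
  have hΔeq : Δ = star U * S * U := by
    rw [hSdiag, ← Matrix.mul_assoc, ← Matrix.mul_assoc, hUU', Matrix.one_mul, Matrix.mul_assoc, hUU',
      Matrix.mul_one]
  -- conjugated factors `Q_{v,i} = U* P_{v,i} U`
  set Q : Fin n → Fin k → Matrix (Fin D) (Fin D) ℂ := fun v i => star U * P v i * U with hQdef
  have hQpsd : ∀ v i, (Q v i).PosSemidef := fun v i => by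
    have := (hP v i).conjTranspose_mul_mul_same U
    simpa only [hQdef, star_eq_conjTranspose] using this
  have hQsum : ∀ v, ∑ i, Q v i = Δ := by
    intro v
    simp only [hQdef, ← Finset.sum_mul, ← Finset.mul_sum, hS v, hΔeq]
  have hQorth : ∀ v i j, i ≠ j → Q v i * Q v j = 0 := by
    intro v i j hij
    simp only [hQdef]
    calc star U * P v i * U * (star U * P v j * U)
        = star U * (P v i * (U * star U) * P v j) * U := by simp only [Matrix.mul_assoc]
      _ = 0 := by rw [hUU, Matrix.mul_one, horth v i j hij, Matrix.mul_zero, Matrix.zero_mul]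
  have hconj_tr : ∀ M : Matrix (Fin D) (Fin D) ℂ, (star U * M * U).trace = M.trace := by
    intro M
    rw [trace_mul_cycle, hUU, Matrix.one_mul]
  have hQtr : ∀ v w i j, (Q v i * Q w j).trace = (P v i * P w j).trace := by
    intro v w i j
    simp only [hQdef]
    calc (star U * P v i * U * (star U * P w j * U)).trace
        = (star U * (P v i * (U * star U) * P w j) * U).trace := by simp only [Matrix.mul_assoc]
      _ = (P v i * P w j).trace := by rw [hUU, Matrix.mul_one, hconj_tr]
  -- `Q Δ = Q² = Δ Q`
  have hQΔ : ∀ v i, Q v i * Δ = Q v i * Q v i := by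
    intro v i
    rw [← hQsum v, Finset.mul_sum, Finset.sum_eq_single i]
    · intro j _ hji
      exact hQorth v i j (Ne.symm hji)
    · intro h; exact absurd (Finset.mem_univ i) h
  have hΔQ : ∀ v i, Δ * Q v i = Q v i * Q v i := by
    intro v i
    rw [← hQsum v, Finset.sum_mul, Finset.sum_eq_single i]
    · intro j _ hji
      exact hQorth v j i hji
    · intro h; exact absurd (Finset.mem_univ i) h
  -- entrywise consequences
  have hE4 : ∀ v i a b, μ a ≠ μ b → Q v i a b = 0 := by
    intro v i a b hab
    have h1 := congrFun (congrFun (hQΔ v i) a) b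
    have h2 := congrFun (congrFun (hΔQ v i) a) b
    rw [hΔ, mul_diagonal] at h1
    rw [hΔ, diagonal_mul] at h2
    have h12 : Q v i a b * (μ b : ℂ) = (μ a : ℂ) * Q v i a b := h1.trans h2.symm
    have hne : ((μ b : ℂ) - μ a) ≠ 0 := by
      rw [sub_ne_zero]; exact_mod_cast hab.symm
    have : Q v i a b * ((μ b : ℂ) - μ a) = 0 := by rw [mul_sub, h12]; ring
    exact (mul_eq_zero.mp this).resolve_right hne
  have hE5 : ∀ v i a b, (Q v i * Q v i) a b = Q v i a b * (μ b : ℂ) := by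
    intro v i a b
    rw [← hQΔ, hΔ, mul_diagonal]
  have hE6 : ∀ v i a b, μ a = 0 → Q v i a b = 0 := by
    intro v i a b ha
    have hH : (Q v i).IsHermitian := (hQpsd v i).1
    have hQQ : (Q v i * Q v i) a a = 0 := by rw [hE5, ha]; simp
    rw [Matrix.mul_apply] at hQQ
    have hterm : ∀ c, Q v i a c * Q v i c a = ((Complex.normSq (Q v i a c) : ℝ) : ℂ) := by
      intro c
      rw [← hH.apply c a, Complex.star_def, Complex.mul_conj]
    simp_rw [hterm] at hQQ
    have hsum : ∑ c, Complex.normSq (Q v i a c) = 0 := by exact_mod_cast hQQ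
    have hz := (Finset.sum_eq_zero_iff_of_nonneg fun c _ => Complex.normSq_nonneg (Q v i a c)).1 hsum b
      (Finset.mem_univ b)
    exact Complex.normSq_eq_zero.mp hz
  -- the nonzero eigenvalues and their fibres
  set T : Finset ℝ := (Finset.univ.image μ).filter (fun s => s ≠ 0) with hT
  set sval : Fin T.card → ℝ := fun l => ((T.equivFin.symm l : T) : ℝ) with hsval
  have hsT : ∀ l, sval l ∈ T := fun l => (T.equivFin.symm l).2
  have hs0 : ∀ l, sval l ≠ 0 := fun l => (Finset.mem_filter.mp (hsT l)).2
  set fib : Fin T.card → Finset (Fin D) := fun l => Finset.univ.filter (fun a => μ a = sval l) with hfib_def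
  have hmem_fib : ∀ l a, a ∈ fib l ↔ μ a = sval l := fun l a => by simp [hfib_def]
  set d : Fin T.card → ℕ := fun l => (fib l).card with hd_def
  let el : (l : Fin T.card) → Fin (d l) ≃ (fib l) := fun l => (fib l).equivFin.symm
  let emb : (l : Fin T.card) → Fin (d l) → Fin D := fun l x => ((el l x : fib l) : Fin D)
  have hemb_inj : ∀ l, Function.Injective (emb l) := fun l x y h =>
    (el l).injective (Subtype.ext h)
  have hemb_μ : ∀ l x, μ (emb l x) = sval l := fun l x => (hmem_fib l _).mp (el l x).2
  have hd : ∀ l, 0 < d l := by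
    intro l
    obtain ⟨hmem, -⟩ := Finset.mem_filter.mp (hsT l)
    obtain ⟨a, -, ha⟩ := Finset.mem_image.mp hmem
    exact Finset.card_pos.mpr ⟨a, (hmem_fib l a).mpr ha⟩
  -- sums over a fibre
  have hsum_fib : ∀ l (g : Fin D → ℂ), ∑ x : Fin (d l), g (emb l x) = ∑ a ∈ fib l, g a := by
    intro l g
    rw [Fintype.sum_equiv (el l) (fun x => g (emb l x)) (fun y => g y) (fun x => rfl),
      Finset.sum_coe_sort (fib l) g]
  -- sums over all fibres exhaust the indices `a` with `μ a ≠ 0`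
  have hfib : ∀ g : Fin D → ℂ, (∀ a, μ a = 0 → g a = 0) →
      ∑ l, ∑ x : Fin (d l), g (emb l x) = ∑ a, g a := by
    intro g hg
    simp_rw [hsum_fib]
    have step1 : ∑ l, ∑ a ∈ fib l, g a = ∑ t ∈ T, ∑ a ∈ Finset.univ.filter (fun a => μ a = t), g a := by
      rw [← Finset.sum_coe_sort T]
      exact Fintype.sum_equiv T.equivFin.symm _ _ fun l => rfl
    have step2 : ∀ t ∈ T, Finset.univ.filter (fun a => μ a = t) =
        (Finset.univ.filter (fun a => μ a ≠ 0)).filter (fun a => μ a = t) := by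
      intro t ht
      have ht0 : t ≠ 0 := (Finset.mem_filter.mp ht).2
      ext a
      simp only [Finset.mem_filter, Finset.mem_univ, true_and]
      constructor
      · intro h; exact ⟨h ▸ ht0, h⟩
      · intro h; exact h.2
    rw [step1, Finset.sum_congr rfl fun t ht => by rw [step2 t ht]]
    rw [Finset.sum_fiberwise_of_maps_to (fun a ha => by
      refine Finset.mem_filter.mpr ⟨Finset.mem_image.mpr ⟨a, Finset.mem_univ a, rfl⟩, ?_⟩
      exact (Finset.mem_filter.mp ha).2)]
    exact Finset.sum_filter_of_ne fun a _ hga => fun h => hga (hg a h)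
  -- block multiplication on a fibre
  have hblock : ∀ l v i w j, (Q v i).submatrix (emb l) (emb l) * (Q w j).submatrix (emb l) (emb l)
      = (Q v i * Q w j).submatrix (emb l) (emb l) := by
    intro l v i w j
    ext x y
    simp only [Matrix.mul_apply, submatrix_apply]
    rw [hsum_fib l (fun c => Q v i (emb l x) c * Q w j c (emb l y))]
    apply Finset.sum_subset (Finset.subset_univ _)
    intro c _ hc
    have hμc : μ c ≠ sval l := fun h => hc ((hmem_fib l c).mpr h)
    rw [hE4 v i (emb l x) c (by rw [hemb_μ]; exact Ne.symm hμc), zero_mul]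
  -- the data
  refine ⟨T.card, d, fun l => sval l ^ 2 * d l,
    fun l v i => (((sval l)⁻¹ : ℝ) : ℂ) • (Q v i).submatrix (emb l) (emb l),
    hd, fun l => mul_nonneg (sq_nonneg _) (Nat.cast_nonneg _), ?_, ?_, ?_, ?_⟩
  · -- `Σ_l s_l² d_l = Σ_a μ_a² = Tr(S²) = 1`
    have h1 : ∀ l, ∑ x : Fin (d l), ((μ (emb l x) : ℂ)) ^ 2 = ((sval l : ℝ) : ℂ) ^ 2 * (d l : ℂ) := by
      intro l
      simp_rw [hemb_μ]
      rw [Finset.sum_const, Finset.card_univ, Fintype.card_fin]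
      simp only [nsmul_eq_mul]
      ring
    have h2 := hfib (fun a => ((μ a : ℂ)) ^ 2) (fun a ha => by rw [ha]; simp)
    simp_rw [h1] at h2
    have h3 : ∑ a, ((μ a : ℂ)) ^ 2 = (Δ * Δ).trace := by
      rw [hΔ, diagonal_mul_diagonal, trace_diagonal]
      simp [sq]
    have h4 : (Δ * Δ).trace = 1 := by
      rw [hΔeq]
      calc (star U * S * U * (star U * S * U)).trace
          = (star U * (S * (U * star U) * S) * U).trace := by simp only [Matrix.mul_assoc]
        _ = 1 := by rw [hUU, Matrix.mul_one, hconj_tr, htr]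
    have : ((∑ l, sval l ^ 2 * (d l : ℝ) : ℝ) : ℂ) = (1 : ℂ) := by
      push_cast
      rw [h2, h3, h4]
    exact_mod_cast this
  · -- projections
    intro l v i
    refine ⟨?_, ?_⟩
    · have hH : ((Q v i).submatrix (emb l) (emb l)).IsHermitian := (hQpsd v i).1.submatrix _
      unfold Matrix.IsHermitian at hH ⊢
      rw [conjTranspose_smul, hH, Complex.star_def, Complex.conj_ofReal]
    · rw [smul_mul_smul_comm, hblock]
      have hsq : (Q v i * Q v i).submatrix (emb l) (emb l) =
          ((sval l : ℝ) : ℂ) • (Q v i).submatrix (emb l) (emb l) := by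
        ext x y
        rw [submatrix_apply, Matrix.smul_apply, submatrix_apply, smul_eq_mul, hE5, hemb_μ, mul_comm]
      have hs : ((sval l : ℝ) : ℂ) ≠ 0 := by exact_mod_cast hs0 l
      have hcoef : (((sval l)⁻¹ : ℝ) : ℂ) * (((sval l)⁻¹ : ℝ) : ℂ) * ((sval l : ℝ) : ℂ) =
          (((sval l)⁻¹ : ℝ) : ℂ) := by
        push_cast
        field_simp
      rw [hsq, smul_smul, hcoef]
  · -- `Σ_i E = I` on each fibre
    intro l v
    rw [← Finset.smul_sum]
    have : ∑ i, (Q v i).submatrix (emb l) (emb l) = (∑ i, Q v i).submatrix (emb l) (emb l) := by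
      ext x y
      simp only [submatrix_apply, Matrix.sum_apply]
    rw [this, hQsum v, hΔ]
    have hdiag : (diagonal fun a => (μ a : ℂ)).submatrix (emb l) (emb l) =
        ((sval l : ℝ) : ℂ) • (1 : Matrix (Fin (d l)) (Fin (d l)) ℂ) := by
      ext x y
      rw [submatrix_apply, diagonal_apply, Matrix.smul_apply, one_apply, smul_eq_mul, mul_ite, mul_one,
        mul_zero]
      simp only [(hemb_inj l).eq_iff, hemb_μ]
    rw [hdiag, smul_smul]
    have : ((sval l : ℝ) : ℂ) ≠ 0 := by exact_mod_cast hs0 l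
    rw [show (((sval l)⁻¹ : ℝ) : ℂ) * ((sval l : ℝ) : ℂ) = 1 by push_cast; field_simp, one_smul]
  · -- the trace formula
    intro v w i j
    have hterm : ∀ l, (((sval l ^ 2 * d l) / d l : ℝ) : ℂ) *
        ((((sval l)⁻¹ : ℝ) : ℂ) • (Q v i).submatrix (emb l) (emb l) *
          ((((sval l)⁻¹ : ℝ) : ℂ) • (Q w j).submatrix (emb l) (emb l))).trace =
        ∑ x : Fin (d l), (Q v i * Q w j) (emb l x) (emb l x) := by
      intro l
      rw [smul_mul_smul_comm, hblock, trace_smul, smul_eq_mul]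
      have hdl : (d l : ℂ) ≠ 0 := by exact_mod_cast (hd l).ne'
      have hsl : ((sval l : ℝ) : ℂ) ≠ 0 := by exact_mod_cast hs0 l
      have hcoef : (((sval l ^ 2 * d l) / d l : ℝ) : ℂ) * ((((sval l)⁻¹ : ℝ) : ℂ) * (((sval l)⁻¹ : ℝ) : ℂ))
          = 1 := by
        push_cast
        field_simp
      rw [← mul_assoc, hcoef, one_mul]
      simp only [trace, diag_apply, submatrix_apply]
    simp_rw [hterm]
    rw [hfib (fun a => (Q v i * Q w j) a a) (fun a ha => by
      rw [Matrix.mul_apply]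
      exact Finset.sum_eq_zero fun c _ => by rw [hE6 v i a c ha, zero_mul])]
    rw [← hQtr]
    rfl


/-- Hermitian `A, B` with `Tr(A A) = Tr(A B) = Tr(B B) = 1` coincide (`‖A − B‖_F² = 0`). [folklore] -/
private theorem eq_of_trace_eq_one {D : ℕ} {A B : Matrix (Fin D) (Fin D) ℂ} (hA : A.IsHermitian)
    (hB : B.IsHermitian) (hAA : (A * A).trace = 1) (hAB : (A * B).trace = 1)
    (hBB : (B * B).trace = 1) : A = B := by
  have hBA : (B * A).trace = 1 := by rw [trace_mul_comm, hAB]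
  have h0 : ((A - B)ᴴ * (A - B)).trace = 0 := by
    rw [conjTranspose_sub, hA.eq, hB.eq, Matrix.sub_mul, Matrix.mul_sub, Matrix.mul_sub, trace_sub,
      trace_sub, trace_sub, hAA, hAB, hBA, hBB]
    ring
  exact sub_eq_zero.mp (trace_conjTranspose_mul_self_eq_zero_iff.mp h0)

/-! ### The dictionary and the closedness transfer -/

/-- **Synchronous quantum correlations are exactly the trace-normalised synchronous cpsd Gram
families**: `p ∈ C_q^s(n,k)` iff the `nk × nk` matrix `(p(i,j|v,w))_{(v,i),(w,j)}` is completely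
positive semidefinite (PSVW Def. 1: Hermitian psd factors), `Σ_{i,j} p(i,j|v,w) = 1` for all `v, w`, and
`p(i,j|v,v) = 0` for `i ≠ j`. (⇒: `isCpsd_corrGram_of_mem` & co.; ⇐: `exists_tracial_data`; `n = 0`:
the one-block algebra `ℂ`.) [cite: DykemaPaulsenPrakash2019, Cor. 2.12 (p06); PrakashEtAl2017, Def. 1
(p04) and Thm. 1 (p05, the cpsd/quantum-behaviour dictionary)] -/
theorem mem_syncQuantumCorr_iff {n k : ℕ} (p : Fin n → Fin n → Fin k → Fin k → ℝ) :
    p ∈ syncQuantumCorr n k ↔ IsCpsd (corrGram p) ∧ (∀ v w, ∑ i, ∑ j, p v w i j = 1) ∧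
      ∀ v i j, i ≠ j → p v v i j = 0 := by
  classical
  constructor
  · intro hp
    exact ⟨isCpsd_corrGram_of_mem hp, sum_sum_eq_one_of_mem hp, fun v _ _ hij =>
      eq_zero_of_mem_of_ne hp v hij⟩
  · rintro ⟨⟨D, P, hP, hX⟩, hnorm, hsync⟩
    rcases Nat.eq_zero_or_pos n with hn | hn
    · subst hn
      exact ⟨1, fun _ => 1, fun _ => 1, fun _ v _ => v.elim0, fun _ => Nat.one_pos,
        fun _ => zero_le_one, by simp, fun _ v => v.elim0, fun _ v => v.elim0, fun v => v.elim0⟩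
    · obtain ⟨v₀⟩ : Nonempty (Fin n) := Fin.pos_iff_nonempty.mp hn
      have hX' : ∀ v w i j, ((p v w i j : ℝ) : ℂ) = (P (v, i) * P (w, j)).trace := fun v w i j =>
        hX (v, i) (w, j)
      -- orthogonality from the synchronous zeros
      have horth : ∀ v i j, i ≠ j → P (v, i) * P (v, j) = 0 := fun v i j hij =>
        mul_eq_zero_of_psd_trace_eq_zero (hP _) (hP _) (by rw [← hX', hsync v i j hij]; simp)
      -- all the sums `S_v = Σ_i P_{(v,i)}` coincide
      have hSpsd : ∀ v, (∑ i, P (v, i)).PosSemidef := fun v => posSemidef_sum _ fun i _ => hP _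
      have htrS : ∀ v w, ((∑ i, P (v, i)) * (∑ j, P (w, j))).trace = 1 := by
        intro v w
        rw [Finset.sum_mul, trace_sum]
        simp_rw [Finset.mul_sum, trace_sum, ← hX']
        have := hnorm v w
        exact_mod_cast congrArg (fun r : ℝ => (r : ℂ)) this
      have hSeq : ∀ v, ∑ i, P (v, i) = ∑ i, P (v₀, i) := fun v =>
        eq_of_trace_eq_one (hSpsd v).1 (hSpsd v₀).1 (htrS v v) (htrS v v₀) (htrS v₀ v₀)
      obtain ⟨L, d, wt, E, hd, hwt, hwt1, hE, hE1, hPE⟩ :=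
        exists_tracial_data (fun v i => P (v, i)) (fun v i => hP _) horth (∑ i, P (v₀, i))
          (hSpsd v₀).1 hSeq (htrS v₀ v₀)
      exact ⟨L, d, wt, E, hd, hwt, hwt1, hE, hE1, fun v w i j => by rw [hX', hPE]⟩

/-- The constraints of `mem_syncQuantumCorr_iff` are closed conditions and `p ↦ corrGram p` is
continuous, so **if the cone `CS_+` of `([n] × [k])`-indexed cpsd matrices is closed then `C_q^s(n,k)`
is closed**. [cite: GriblingDelaatLaurent2019, §1 (p04: "Exploiting the connection between the
completely positive semidefinite cone and quantum correlations it follows …"); AbbasiKlinglerNetzer2020,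
§2 (p05)] -/
theorem isClosed_syncQuantumCorr_of_isClosed_cpsd {n k : ℕ}
    (h : IsClosed {X : Matrix (Fin n × Fin k) (Fin n × Fin k) ℝ | IsCpsd X}) :
    IsClosed (syncQuantumCorr n k) := by
  have hset : syncQuantumCorr n k = corrGram ⁻¹' {X | IsCpsd X} ∩
      ((⋂ v, ⋂ w, {p : Fin n → Fin n → Fin k → Fin k → ℝ | ∑ i, ∑ j, p v w i j = 1}) ∩
        ⋂ v, ⋂ i, ⋂ j, {p : Fin n → Fin n → Fin k → Fin k → ℝ | i ≠ j → p v v i j = 0}) := by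
    ext p
    rw [mem_syncQuantumCorr_iff]
    simp only [Set.mem_inter_iff, Set.mem_preimage, Set.mem_setOf_eq, Set.mem_iInter]
  rw [hset]
  refine (h.preimage (continuous_corrGram n k)).inter (IsClosed.inter ?_ ?_)
  · refine isClosed_iInter fun v => isClosed_iInter fun w => isClosed_eq ?_ continuous_const
    exact continuous_finsetSum _ fun i _ => continuous_finsetSum _ fun j _ =>
      (continuous_apply j).comp <| (continuous_apply i).comp <|
        (continuous_apply w).comp (continuous_apply v)
  · refine isClosed_iInter fun v => isClosed_iInter fun i => isClosed_iInter fun j => ?_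
    by_cases hij : i = j
    · convert isClosed_univ
      ext p
      simp [hij]
    · have : {p : Fin n → Fin n → Fin k → Fin k → ℝ | i ≠ j → p v v i j = 0} =
          {p | p v v i j = 0} := by
        ext p; simp [hij]
      rw [this]
      exact isClosed_eq ((continuous_apply j).comp <| (continuous_apply i).comp <|
        (continuous_apply v).comp (continuous_apply v)) continuous_const

/-! ### Reindexing and padding the cpsd cone -/

/-- `CS_+`-factorizations restrict to principal submatrices / reindexings (factors `P ∘ f`).
[cite: PrakashEtAl2017, Def. 1 (p04)] -/
theorem HasCpsdFactorization.submatrix {ι ι' : Type*} {X : Matrix ι ι ℝ} {d : ℕ}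
    (h : HasCpsdFactorization X d) (f : ι' → ι) : HasCpsdFactorization (X.submatrix f f) d := by
  obtain ⟨P, hP, hX⟩ := h
  exact ⟨fun a => P (f a), fun a => hP _, fun a b => hX _ _⟩

/-- Principal submatrices / reindexings of cpsd matrices are cpsd. [cite: PrakashEtAl2017, §1.1 (p03)] -/
theorem IsCpsd.submatrix {ι ι' : Type*} {X : Matrix ι ι ℝ} (h : IsCpsd X) (f : ι' → ι) :
    IsCpsd (X.submatrix f f) := by
  obtain ⟨d, hd⟩ := h
  exact ⟨d, hd.submatrix f⟩

/-- Being cpsd is invariant under reindexing along an equivalence. [cite: PrakashEtAl2017, §1.1 (p03)] -/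
theorem isCpsd_submatrix_equiv_iff {ι ι' : Type*} {X : Matrix ι ι ℝ} (e : ι' ≃ ι) :
    IsCpsd (X.submatrix e e) ↔ IsCpsd X := by
  refine ⟨fun h => ?_, fun h => h.submatrix e⟩
  have := h.submatrix e.symm
  rwa [submatrix_submatrix, Equiv.self_comp_symm, submatrix_id_id] at this

/-- Closedness of the cpsd cone is invariant under reindexing the matrices along an equivalence
(`X ↦ X.submatrix e e` is a homeomorphism preserving `IsCpsd`). [folklore] -/
private theorem isClosed_cpsd_iff_of_equiv {ι ι' : Type*} [Fintype ι] [Fintype ι'] (e : ι' ≃ ι) :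
    IsClosed {X : Matrix ι ι ℝ | IsCpsd X} ↔ IsClosed {Y : Matrix ι' ι' ℝ | IsCpsd Y} := by
  constructor
  · intro h
    have hset : {Y : Matrix ι' ι' ℝ | IsCpsd Y} =
        (fun Y : Matrix ι' ι' ℝ => Y.submatrix e.symm e.symm) ⁻¹' {X | IsCpsd X} := by
      ext Y; simp only [Set.mem_setOf_eq, Set.mem_preimage, isCpsd_submatrix_equiv_iff]
    rw [hset]
    exact h.preimage (continuous_id.matrix_submatrix _ _)
  · intro h
    have hset : {X : Matrix ι ι ℝ | IsCpsd X} =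
        (fun X : Matrix ι ι ℝ => X.submatrix e e) ⁻¹' {Y | IsCpsd Y} := by
      ext X; simp only [Set.mem_setOf_eq, Set.mem_preimage, isCpsd_submatrix_equiv_iff]
    rw [hset]
    exact h.preimage (continuous_id.matrix_submatrix _ _)

/-- Zero-padding `X ↦ X ⊕ 0_{b−a}` is continuous and satisfies `X ⊕ 0 ∈ CS_+^b ↔ X ∈ CS_+^a`
(PSVW Lemma 4, `≤` half, and restriction to a principal submatrix), so **if `CS_+^b` is closed then so
is `CS_+^a`** (`a ≤ b`); contrapositively non-closure propagates upward ("for `n ≥ 10`").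
[cite: PrakashEtAl2017, Lemma 4 (p10); AbbasiKlinglerNetzer2020, §2 (p05, "`n ≥ 10`")] -/
theorem isClosed_cpsd_of_le {a b : ℕ} (hab : a ≤ b)
    (h : IsClosed {X : Matrix (Fin b) (Fin b) ℝ | IsCpsd X}) :
    IsClosed {X : Matrix (Fin a) (Fin a) ℝ | IsCpsd X} := by
  let e : Fin b ≃ Fin a ⊕ Fin (b - a) := (finCongr (Nat.add_sub_cancel' hab).symm).trans
    finSumFinEquiv.symm
  let pad : Matrix (Fin a) (Fin a) ℝ → Matrix (Fin b) (Fin b) ℝ := fun X =>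
    (Matrix.fromBlocks X 0 0 (0 : Matrix (Fin (b - a)) (Fin (b - a)) ℝ)).submatrix e e
  have hpad : Continuous pad :=
    (continuous_id.matrix_fromBlocks continuous_const continuous_const continuous_const).matrix_submatrix
      _ _
  have hiff : ∀ X, IsCpsd (pad X) ↔ IsCpsd X := by
    intro X
    constructor
    · intro hX
      have := hX.submatrix (e.symm ∘ Sum.inl)
      have hback : (pad X).submatrix (e.symm ∘ Sum.inl) (e.symm ∘ Sum.inl) = X := by
        ext i j
        simp [pad]
      rwa [hback] at this
    · rintro ⟨d, hd⟩
      have h0 : HasCpsdFactorization (0 : Matrix (Fin (b - a)) (Fin (b - a)) ℝ) 0 :=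
        ⟨fun _ => 0, fun _ => PosSemidef.zero, fun i j => by simp⟩
      exact ⟨d + 0, (hd.fromBlocks_diag h0).submatrix e⟩
  have hset : {X : Matrix (Fin a) (Fin a) ℝ | IsCpsd X} = pad ⁻¹' {Y | IsCpsd Y} := by
    ext X; simp only [Set.mem_setOf_eq, Set.mem_preimage, hiff]
  rw [hset]
  exact h.preimage hpad

/-! ### Consequences of DPP Theorem 4.2 for the cpsd cone -/

/-- **The cone `CS_+` of `([5] × [2])`-indexed cpsd matrices is not closed**, modulo DPP Theorem 4.2.
[cite: DykemaPaulsenPrakash2019, Thm. 4.2 (p11); GriblingDelaatLaurent2019, §1 (p04)] -/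
theorem not_isClosed_cpsd_prod (h42 : DykemaPaulsenPrakash2019_thm42) :
    ¬ IsClosed {X : Matrix (Fin 5 × Fin 2) (Fin 5 × Fin 2) ℝ | IsCpsd X} :=
  fun h => h42 (isClosed_syncQuantumCorr_of_isClosed_cpsd h)

/-- **`CS_+^{10}` is not closed**, modulo DPP Theorem 4.2 ("The results in [DPP17] show that this
already holds for `n ≥ 10`"). [cite: GriblingDelaatLaurent2019, §1 (p04); AbbasiKlinglerNetzer2020, §2
(p05); DykemaPaulsenPrakash2019, Thm. 4.2 (p11)] -/
theorem not_isClosed_cpsd_fin_ten (h42 : DykemaPaulsenPrakash2019_thm42) :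
    ¬ IsClosed {X : Matrix (Fin 10) (Fin 10) ℝ | IsCpsd X} := fun h =>
  not_isClosed_cpsd_prod h42
    ((isClosed_cpsd_iff_of_equiv (finProdFinEquiv : Fin 5 × Fin 2 ≃ Fin 10)).mp h)

/-- **`CS_+^m` is not closed for every `m ≥ 10`**, modulo DPP Theorem 4.2 — the negative answer, for
`m ≥ 10`, to FGPRT §8's and PSVW p03's closedness question (`5 ≤ m ≤ 9` open, AKN p05).
[cite: GriblingDelaatLaurent2019, §1 (p04); AbbasiKlinglerNetzer2020, §2 (p05); FawziEtAl2015, §8 (p23);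
PrakashEtAl2017, §1.1 (p03)] -/
theorem not_isClosed_cpsd_of_ten_le (h42 : DykemaPaulsenPrakash2019_thm42) {m : ℕ} (hm : 10 ≤ m) :
    ¬ IsClosed {X : Matrix (Fin m) (Fin m) ℝ | IsCpsd X} :=
  fun h => not_isClosed_cpsd_fin_ten h42 (isClosed_cpsd_of_le hm h)

/-! ### Bounded cpsd-rank sets are closed; the cpsd-rank is unbounded -/

/-- Frobenius bound: `|P_{ab}|² ≤ Σ_{x,c} |P_{xc}|² = Tr(P P)` for Hermitian `P`.
[cite: AbbasiKlinglerNetzer2020, Lemma 7 proof (p06: "`A_{ii} = tr(A_i A_i) = ‖A_i‖²` are bounded")] -/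
private theorem normSq_apply_le_trace {d : ℕ} {P : Matrix (Fin d) (Fin d) ℂ} (hP : P.IsHermitian)
    (a b : Fin d) : Complex.normSq (P a b) ≤ ((P * P).trace).re := by
  have h : ((P * P).trace).re = ∑ x, ∑ c, Complex.normSq (P x c) := by
    simp only [trace, diag_apply, mul_apply, Complex.re_sum]
    refine Finset.sum_congr rfl fun x _ => Finset.sum_congr rfl fun c _ => ?_
    rw [← hP.apply c x, Complex.star_def, Complex.mul_conj, Complex.ofReal_re]
  rw [h]
  exact (Finset.single_le_sum (fun c _ => Complex.normSq_nonneg (P a c)) (Finset.mem_univ b)).trans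
    (Finset.single_le_sum (fun x _ => Finset.sum_nonneg fun c _ => Complex.normSq_nonneg (P x c))
      (Finset.mem_univ a))

/-- The psd matrices form a closed set (`Mᴴ = M` and `Re(x* M x) ≥ 0`, `Im(x* M x) = 0` are closed
conditions). [cite: AbbasiKlinglerNetzer2020, Lemma 7 proof (p06: "`S^r_+` is closed")] -/
private theorem isClosed_setOf_posSemidef (d : ℕ) :
    IsClosed {M : Matrix (Fin d) (Fin d) ℂ | M.PosSemidef} := by
  have hset : {M : Matrix (Fin d) (Fin d) ℂ | M.PosSemidef} = {M | Mᴴ = M} ∩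
      ⋂ x : Fin d → ℂ, {M | 0 ≤ (star x ⬝ᵥ (M *ᵥ x)).re ∧ (star x ⬝ᵥ (M *ᵥ x)).im = 0} := by
    ext M
    simp only [Set.mem_setOf_eq, Set.mem_inter_iff, Set.mem_iInter, posSemidef_iff_dotProduct_mulVec,
      Matrix.IsHermitian, Complex.nonneg_iff]
    exact ⟨fun ⟨h1, h2⟩ => ⟨h1, fun x => ⟨(h2 x).1, (h2 x).2.symm⟩⟩,
      fun ⟨h1, h2⟩ => ⟨h1, fun x => ⟨(h2 x).1, (h2 x).2.symm⟩⟩⟩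
  rw [hset]
  refine (isClosed_eq continuous_id.matrix_conjTranspose continuous_id).inter ?_
  refine isClosed_iInter fun x => ?_
  have hc : Continuous fun M : Matrix (Fin d) (Fin d) ℂ => star x ⬝ᵥ (M *ᵥ x) :=
    continuous_const.dotProduct (continuous_id.matrix_mulVec continuous_const)
  exact (isClosed_le continuous_const (Complex.continuous_re.comp hc)).inter
    (isClosed_eq (Complex.continuous_im.comp hc) continuous_const)

/-- **Abbasi–Klingler–Netzer Lemma 7** (p06, verbatim): "For each `n, r ≥ 1`, the set `CPSD^n_{≤ r}`
[of matrices with a Gram representation by psd matrices of size `r`] is closed" — here for the tree's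
`HasCpsdFactorization · d` (Hermitian factors) and any finite index type. Printed proof
(Bolzano–Weierstrass on the factors, bounded by `‖A_i‖² = A_{ii}`) rendered as: near any `X` the set is
the continuous image of the COMPACT box of psd factor tuples with `|(P_i)_{ab}| ≤ C`, pulled back along
`ℝ ↪ ℂ`. (The "semialgebraic" clause of Lemma 7 is not typed.) [cite: AbbasiKlinglerNetzer2020, Lemma 7
(p06)] -/
theorem isClosed_setOf_hasCpsdFactorization (ι : Type*) [Fintype ι] (d : ℕ) :
    IsClosed {X : Matrix ι ι ℝ | HasCpsdFactorization X d} := by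
  classical
  let gram : (ι → Matrix (Fin d) (Fin d) ℂ) → Matrix ι ι ℂ :=
    fun P => Matrix.of fun i j => (P i * P j).trace
  have hgram : Continuous gram := by
    refine continuous_pi fun i => continuous_pi fun j => ?_
    have hi : Continuous fun P : ι → Matrix (Fin d) (Fin d) ℂ => P i := continuous_apply i
    have hj : Continuous fun P : ι → Matrix (Fin d) (Fin d) ℂ => P j := continuous_apply j
    exact (hi.matrix_mul hj).matrix_trace
  let cast : Matrix ι ι ℝ → Matrix ι ι ℂ := fun X => X.map ((↑) : ℝ → ℂ)
  have hcast : Continuous cast := continuous_id.matrix_map Complex.continuous_ofReal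
  let K : ℝ → Set (ι → Matrix (Fin d) (Fin d) ℂ) := fun C =>
    {P | ∀ i, (P i).PosSemidef} ∩ {P | ∀ i a b, ‖P i a b‖ ≤ C}
  have hK : ∀ C, IsCompact (K C) := by
    intro C
    have hbox : IsCompact {P : ι → Matrix (Fin d) (Fin d) ℂ | ∀ i a b, ‖P i a b‖ ≤ C} := by
      have : {P : ι → Matrix (Fin d) (Fin d) ℂ | ∀ i a b, ‖P i a b‖ ≤ C} =
          Set.pi Set.univ fun _ => Set.pi Set.univ fun _ => Set.pi Set.univ fun _ =>
            Metric.closedBall (0 : ℂ) C := by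
        ext P
        simp only [Set.mem_setOf_eq]
        constructor
        · intro h i _ a _ b _
          rw [Metric.mem_closedBall, dist_zero_right]
          exact h i a b
        · intro h i a b
          have := h i (Set.mem_univ _) a (Set.mem_univ _) b (Set.mem_univ _)
          rwa [Metric.mem_closedBall, dist_zero_right] at this
      rw [this]
      exact isCompact_univ_pi fun _ => isCompact_univ_pi fun _ => isCompact_univ_pi fun _ =>
        isCompact_closedBall _ _
    have hpsd : IsClosed {P : ι → Matrix (Fin d) (Fin d) ℂ | ∀ i, (P i).PosSemidef} := by
      have : {P : ι → Matrix (Fin d) (Fin d) ℂ | ∀ i, (P i).PosSemidef} =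
          ⋂ i, (fun P => P i) ⁻¹' {M | M.PosSemidef} := by
        ext P; simp
      rw [this]
      exact isClosed_iInter fun i => (isClosed_setOf_posSemidef d).preimage (continuous_apply i)
    exact hbox.inter_left hpsd
  have hA : ∀ C, IsClosed (cast ⁻¹' (gram '' K C)) := fun C =>
    ((hK C).image hgram).isClosed.preimage hcast
  have hsub : ∀ C, cast ⁻¹' (gram '' K C) ⊆ {X | HasCpsdFactorization X d} := by
    rintro C X ⟨P, ⟨hP, -⟩, hPX⟩
    refine ⟨P, hP, fun i j => ?_⟩
    have := congrFun (congrFun hPX i) j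
    simpa [gram, cast] using this.symm
  have hsup : ∀ C, 0 ≤ C →
      {X | HasCpsdFactorization X d} ∩ {X : Matrix ι ι ℝ | ∀ i, X i i ≤ C ^ 2} ⊆
        cast ⁻¹' (gram '' K C) := by
    rintro C hC X ⟨⟨P, hP, hX⟩, hdiag⟩
    refine ⟨P, ⟨hP, fun i a b => ?_⟩, ?_⟩
    · have h1 : Complex.normSq (P i a b) ≤ ((P i * P i).trace).re :=
        normSq_apply_le_trace (hP i).1 a b
      have h2 : ((P i * P i).trace).re = X i i := by rw [← hX i i, Complex.ofReal_re]
      have h3 : ‖P i a b‖ ^ 2 ≤ C ^ 2 := by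
        rw [Complex.sq_norm]
        linarith [hdiag i]
      exact (sq_le_sq₀ (norm_nonneg _) hC).mp h3
    · ext i j
      simp [gram, cast, hX i j]
  refine isClosed_of_closure_subset fun X hX => ?_
  set C : ℝ := Real.sqrt (1 + ∑ i, |X i i|) with hCdef
  have hC : 0 ≤ C := Real.sqrt_nonneg _
  have hCX : ∀ i, X i i < C ^ 2 := by
    intro i
    rw [hCdef, Real.sq_sqrt (by positivity)]
    have := Finset.single_le_sum (fun j _ => abs_nonneg (X j j)) (Finset.mem_univ i)
    linarith [le_abs_self (X i i)]
  have hUo : IsOpen {Y : Matrix ι ι ℝ | ∀ i, Y i i < C ^ 2} := by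
    have : {Y : Matrix ι ι ℝ | ∀ i, Y i i < C ^ 2} = ⋂ i, {Y | Y i i < C ^ 2} := by ext; simp
    rw [this]
    exact isOpen_iInter_of_finite fun i =>
      isOpen_lt (continuous_id.matrix_elem i i) continuous_const
  have hmem : X ∈ closure ({Y | HasCpsdFactorization Y d} ∩
      {Y : Matrix ι ι ℝ | ∀ i, Y i i < C ^ 2}) :=
    hUo.closure_inter ⟨hX, hCX⟩
  have hsub' : {Y | HasCpsdFactorization Y d} ∩ {Y : Matrix ι ι ℝ | ∀ i, Y i i < C ^ 2} ⊆
      cast ⁻¹' (gram '' K C) :=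
    fun Y hY => hsup C hC ⟨hY.1, fun i => (hY.2 i).le⟩
  exact hsub C ((hA C).closure_subset_iff.mpr hsub' hmem)

/-- **Abbasi–Klingler–Netzer Corollary 8, the mechanism** (p06): "If the cpsd-rank admitted a bound,
there would exist some `r ≥ 1` with `CPSD^n = CPSD^n_{≤ r}`. Consequently, by Lemma 7, the cone `CPSD^n`
would be closed" — so a non-closed `CS_+` carries cpsd matrices of cpsd-rank `> d` for every `d`.
[cite: AbbasiKlinglerNetzer2020, Cor. 8 (p06)] -/
theorem exists_not_hasCpsdFactorization_of_not_isClosed {ι : Type*} [Fintype ι]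
    (h : ¬ IsClosed {X : Matrix ι ι ℝ | IsCpsd X}) (d : ℕ) :
    ∃ X : Matrix ι ι ℝ, IsCpsd X ∧ ¬ HasCpsdFactorization X d := by
  by_contra hne
  apply h
  have hall : ∀ X : Matrix ι ι ℝ, IsCpsd X → HasCpsdFactorization X d :=
    fun X hX => by_contra fun hn => hne ⟨X, hX, hn⟩
  have : {X : Matrix ι ι ℝ | IsCpsd X} = {X | HasCpsdFactorization X d} :=
    Set.ext fun X => ⟨fun hX => hall X hX, fun hX => ⟨d, hX⟩⟩
  rw [this]
  exact isClosed_setOf_hasCpsdFactorization ι d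

/-- **Abbasi–Klingler–Netzer Corollary 8** (p06, verbatim): "For `n ≥ 10` the cpsd-rank of elements
from `CPSD^n` are unbounded" — PSVW's Question (p05–p06: "Is `max{cpsd-rank(X) : X ∈ CS_+^n}` finite or
infinite?") answered INFINITE for `n ≥ 10`, modulo DPP Theorem 4.2. [cite: AbbasiKlinglerNetzer2020,
Cor. 8 (p06); PrakashEtAl2017, Question (p05–p06); GriblingDelaatLaurent2019, §1 (p04)] -/
theorem cpsdRank_unbounded_of_ten_le (h42 : DykemaPaulsenPrakash2019_thm42) {m : ℕ} (hm : 10 ≤ m)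
    (d : ℕ) : ∃ X : Matrix (Fin m) (Fin m) ℝ, IsCpsd X ∧ ¬ HasCpsdFactorization X d :=
  exists_not_hasCpsdFactorization_of_not_isClosed (not_isClosed_cpsd_of_ten_le h42 hm) d


/-- A Gram factorization by REAL psd matrices is a `CS_+`-factorization of the same size (real psd
matrices are Hermitian psd). [cite: PrakashEtAl2017, §1.1 (p03) and §3.1 (p10)] -/
theorem hasCpsdFactorization_of_real {ι : Type*} {X : Matrix ι ι ℝ} {f : ℕ}
    (A : ι → Matrix (Fin f) (Fin f) ℝ) (hA : ∀ i, (A i).PosSemidef)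
    (hX : ∀ i j, X i j = (A i * A j).trace) : HasCpsdFactorization X f := by
  classical
  refine ⟨fun i => (A i).map Complex.ofRealHom, fun i => ?_, fun i j => ?_⟩
  · obtain ⟨B, hB⟩ := CStarAlgebra.nonneg_iff_eq_star_mul_self.mp (hA i).nonneg
    have hmap : (A i).map Complex.ofRealHom =
        (B.map Complex.ofRealHom)ᴴ * B.map Complex.ofRealHom := by
      rw [hB, Matrix.map_mul, star_eq_conjTranspose, conjTranspose_map]
      intro x
      simp
    show ((A i).map Complex.ofRealHom).PosSemidef
    rw [hmap]
    exact posSemidef_conjTranspose_mul_self _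
  · show ((X i j : ℝ) : ℂ) = ((A i).map Complex.ofRealHom * (A j).map Complex.ofRealHom).trace
    rw [hX]
    simp only [trace, diag_apply, Matrix.mul_apply, Matrix.map_apply, Complex.ofRealHom_eq_coe,
      Complex.ofReal_sum, Complex.ofReal_mul]

/-- **FGPRT Problem 9.11 in its printed, real-factor form, answered in the negative for `n ≥ 10`**
(modulo DPP Theorem 4.2): for `m ≥ 10` and every `f` some `m × m` matrix has a Gram factorization
`M_{ij} = ⟨A_i, A_j⟩` by real psd matrices of some size but none by real psd matrices of size `f`
(real psd factors are Hermitian psd factors; conversely PSVW's realification `T/√2` (§3.1) turns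
Hermitian factors of size `D` into real ones of size `2D`).
[cite: FawziEtAl2015, Problem 9.11 (p25); PrakashEtAl2017, §3.1 (p10)] -/
theorem exists_real_cpsd_no_bounded_factorization (h42 : DykemaPaulsenPrakash2019_thm42) {m : ℕ}
    (hm : 10 ≤ m) (f : ℕ) :
    ∃ X : Matrix (Fin m) (Fin m) ℝ,
      (∃ (D : ℕ) (A : Fin m → Matrix (Fin D) (Fin D) ℝ),
        (∀ i, (A i).PosSemidef) ∧ ∀ i j, X i j = (A i * A j).trace) ∧
      ¬ ∃ A : Fin m → Matrix (Fin f) (Fin f) ℝ,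
        (∀ i, (A i).PosSemidef) ∧ ∀ i j, X i j = (A i * A j).trace := by
  classical
  obtain ⟨X, ⟨D, P, hP, hX⟩, hnot⟩ := cpsdRank_unbounded_of_ten_le h42 hm f
  let e : Fin (D + D) ≃ Fin D ⊕ Fin D := finSumFinEquiv.symm
  let T : Matrix (Fin D) (Fin D) ℂ → Matrix (Fin D ⊕ Fin D) (Fin D ⊕ Fin D) ℝ := fun Q =>
    Matrix.fromBlocks (Q.map Complex.re) (-(Q.map Complex.im)) (Q.map Complex.im) (Q.map Complex.re)
  refine ⟨X, ⟨D + D, fun i => (Real.sqrt 2)⁻¹ • (T (P i)).submatrix e e, fun i => ?_, fun i j => ?_⟩,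
    fun ⟨A, hA, hXA⟩ => hnot (hasCpsdFactorization_of_real A hA hXA)⟩
  · exact ((posSemidef_submatrix_equiv e).mpr (posSemidef_realify (hP i))).smul
      (inv_nonneg.mpr (Real.sqrt_nonneg 2))
  · rw [smul_mul_smul_comm, trace_smul, smul_eq_mul, submatrix_mul_equiv, trace_submatrix_equiv',
      trace_realify_mul_realify, ← hX i j, Complex.ofReal_re]
    have h2 : (Real.sqrt 2)⁻¹ * (Real.sqrt 2)⁻¹ * 2 = 1 := by
      rw [← mul_inv, Real.mul_self_sqrt (by norm_num : (0 : ℝ) ≤ 2)]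
      norm_num
    rw [← mul_assoc, h2, one_mul]


/-! ### Small sizes: `CS_+^m` is closed for `m ≤ 4` (appended) -/

/-- The real psd matrices form a closed set (`Mᵀ = M` and `xᵀ M x ≥ 0` are closed conditions).
[cite: AbbasiKlinglerNetzer2020, §2 (p04–p05: "`S_+` … is always a closed convex cone")] -/
private theorem isClosed_setOf_posSemidef_real (ι : Type*) [Fintype ι] :
    IsClosed {M : Matrix ι ι ℝ | M.PosSemidef} := by
  classical
  have hset : {M : Matrix ι ι ℝ | M.PosSemidef} =
      {M | Mᴴ = M} ∩ ⋂ x : ι → ℝ, {M | 0 ≤ star x ⬝ᵥ (M *ᵥ x)} := by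
    ext M
    simp only [Set.mem_setOf_eq, Set.mem_inter_iff, Set.mem_iInter, posSemidef_iff_dotProduct_mulVec,
      Matrix.IsHermitian]
  rw [hset]
  refine (isClosed_eq continuous_id.matrix_conjTranspose continuous_id).inter ?_
  exact isClosed_iInter fun x => isClosed_le continuous_const
    (continuous_const.dotProduct (continuous_id.matrix_mulVec continuous_const))

/-- **The doubly nonnegative cone `DNN` is closed.** [cite: AbbasiKlinglerNetzer2020, §2 (p05);
PrakashEtAl2017, §1.1 (p03)] -/
theorem isClosed_setOf_isDnn (ι : Type*) [Fintype ι] : IsClosed {X : Matrix ι ι ℝ | IsDnn X} := by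
  have hset : {X : Matrix ι ι ℝ | IsDnn X} =
      {X | X.PosSemidef} ∩ ⋂ i, ⋂ j, {X : Matrix ι ι ℝ | 0 ≤ X i j} := by
    ext X
    simp only [IsDnn, Set.mem_setOf_eq, Set.mem_inter_iff, Set.mem_iInter]
  rw [hset]
  exact (isClosed_setOf_posSemidef_real ι).inter (isClosed_iInter fun i => isClosed_iInter fun j =>
    isClosed_le continuous_const (continuous_id.matrix_elem i j))

/-- **`CS_+^4 = DNN^4`** ("for `n ≤ 4` we have `CP^n = CPSD^n = DNN^n`", Maxfield–Minc): `CS_+ ⊆ DNN`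
always, and `DNN^4 ⊆ CP^4 ⊆ CS_+^4` by the tree's `IsDnn.isCp_fin_four` and `IsCp.isCpsd`.
[cite: AbbasiKlinglerNetzer2020, §2 (p05); PrakashEtAl2017, §1.1 (p03, "[MM61]")] -/
theorem isCpsd_iff_isDnn_fin_four {X : Matrix (Fin 4) (Fin 4) ℝ} : IsCpsd X ↔ IsDnn X :=
  ⟨fun h => h.isDnn, fun h => h.isCp_fin_four.isCpsd⟩

/-- **`CS_+^4` is closed** ("and hence `CPSD^n` is closed", `n ≤ 4`). [cite: AbbasiKlinglerNetzer2020,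
§2 (p05)] -/
theorem isClosed_cpsd_fin_four : IsClosed {X : Matrix (Fin 4) (Fin 4) ℝ | IsCpsd X} := by
  have hset : {X : Matrix (Fin 4) (Fin 4) ℝ | IsCpsd X} = {X | IsDnn X} :=
    Set.ext fun X => isCpsd_iff_isDnn_fin_four
  rw [hset]
  exact isClosed_setOf_isDnn (Fin 4)

/-- **`CS_+^m` is closed for every `m ≤ 4`** (AKN §2 p05: "For `n ≤ 4` … `CPSD^n` is closed … it
remains an open problem whether the cone is closed for `n ∈ {5,6,7,8,9}`"; the upper range `n ≥ 10`
is `not_isClosed_cpsd_of_ten_le`). [cite: AbbasiKlinglerNetzer2020, §2 (p05)] -/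
theorem isClosed_cpsd_of_le_four {m : ℕ} (hm : m ≤ 4) :
    IsClosed {X : Matrix (Fin m) (Fin m) ℝ | IsCpsd X} :=
  isClosed_cpsd_of_le hm isClosed_cpsd_fin_four

end Literature.Combinatorics.Optimization
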